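import Literature.NumberTheory.LFunctions.ClassGroupLFunctionExceptionalZeroQuadraticField
import HarnessLib

/-!
# `NoSiegelZeros` ⇒ no exceptional zero for the class group `L`-functions of ANY number field

Topic `Literature/NumberTheory/LFunctions`, namespace `Literature.NumberTheory.LFunctions.NumberField`.
Theorem-only file (no definition, no named fact, no `sorry`): ONE conditional theorem whose hypothesis
is the tree's registered open conjecture `Literature.NumberTheory.LFunctions.NoSiegelZeros` (rh.S34:
`∃ c > 0`, `L(σ, χ) ≠ 0` for `σ > 1 − c/log q`, every real primitive `χ` mod `q ≥ 3`), taken BY NAME.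

**Theorem** (`classGroupLFunction_ne_zero_of_noSiegelZeros`). Assume `NoSiegelZeros`. Then there is
an absolute `c > 0` such that for EVERY number field `K` of degree `n > 1`, every real class group
character `χ` of `K` (`χ = 1`, i.e. `ζ_K`, included) and every real `σ` with
`1 − c/((2n)!·log|d_K|) < σ < 1`: `L(σ, χ) ≠ 0`.

So the classical no-Siegel-zero conjecture for quadratic Dirichlet characters ALONE removes the
exceptional alternative `β₁` from the Landau–Page / Thorner–Zaman dichotomy for the Hilbert class
field ([ThornerZaman2019, Thm. 1.4]) in every degree (unconditionally so in odd degree: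
`classGroupLFunction_ne_zero_of_odd`). Proof: a zero in the window `[1 − 1/(8(2n)! log|d_K|), 1)`
is a zero of `L(s, κ)` for a primitive quadratic `κ` mod `M`, `3 ≤ M ≤ |d_K|`
(`exists_dirichletCharacter_realZero_of_classGroupLFunction_eq_zero`), excluded by `NoSiegelZeros`
on `σ > 1 − c₀/log M ⊇ (1 − c₀/log|d_K|, 1)`; take `c = min(c₀, 1) / 8`.

## References

* J. Thorner, A. Zaman, *A unified and improved Chebotarev density theorem*, Algebra Number Theory 13
  (2019), Thm. 1.4 and §3. [ThornerZaman2019]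
* H. L. Montgomery, R. C. Vaughan, *Multiplicative Number Theory I*, CUP 2007, §11.1–11.2 (Siegel
  zeros; "Presumably, exceptional zeros do not exist"). [MontgomeryVaughan2007]
* H. M. Stark, *Some effective cases of the Brauer–Siegel theorem*, Invent. Math. 23 (1974) 135–152,
  Thm. 3. [Stark1974]
-/

noncomputable section

open scoped NumberField nonZeroDivisors
open Complex NumberField Module

namespace Literature.NumberTheory.LFunctions.NumberField

open Literature.NumberTheory.LFunctions

/-- **`NoSiegelZeros` ⇒ no exceptional zero of any real class group `L`-function, in every degree.**
Under the no-Siegel-zero conjecture for real primitive Dirichlet characters (tree: `NoSiegelZeros`,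
rh.S34, taken by name) there is an absolute `c > 0` such that for every number field `K` of degree
`n > 1`, every class group character `χ` with `χ² = 1` and every real `σ` with
`1 − c/((2n)!·log|d_K|) < σ < 1`, `L(σ, χ) ≠ 0`. CONDITIONAL on an open conjecture (hypothesis `h`).
[cite: ThornerZaman2019, Thm. 1.4 and §3] [cite: Stark1974, Thm. 3] -/
theorem classGroupLFunction_ne_zero_of_noSiegelZeros (h : NoSiegelZeros) :
    ∃ c : ℝ, 0 < c ∧ ∀ (K : Type) [Field K] [NumberField K], 1 < finrank ℚ K →
      ∀ χ : ClassGroup (𝓞 K) →* ℂˣ, χ * χ = 1 → ∀ σ : ℝ,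
        1 - c / (((2 * finrank ℚ K).factorial : ℝ) * Real.log ((discr K).natAbs : ℝ)) < σ → σ < 1 →
          classGroupLFunction K χ σ ≠ 0 := by
  obtain ⟨c₀, hc₀, hNS⟩ := h
  refine ⟨min c₀ 1 / 8, by positivity, fun K _ _ hK χ hχ σ hσ hσ1 h0 => ?_⟩
  set n : ℕ := finrank ℚ K with hn
  have hdK : 3 ≤ (discr K).natAbs := three_le_natAbs_discr K hK
  have hd3 : (3 : ℝ) ≤ ((discr K).natAbs : ℝ) := by exact_mod_cast hdK
  have hlog : 0 < Real.log ((discr K).natAbs : ℝ) := Real.log_pos (by linarith)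
  have hfac1 : (1 : ℝ) ≤ ((2 * n).factorial : ℝ) := by exact_mod_cast Nat.succ_le_of_lt (Nat.factorial_pos _)
  have hfac0 : (0 : ℝ) < ((2 * n).factorial : ℝ) := by linarith
  have hmin1 : min c₀ 1 ≤ 1 := min_le_right _ _
  have hmin0 : min c₀ 1 ≤ c₀ := min_le_left _ _
  have hminpos : 0 < min c₀ 1 := lt_min hc₀ one_pos
  -- the hypothesis window lies inside Stark's window `[1 − 1/(8(2n)! log d), 1)`
  have hwin : 1 - 1 / (8 * ((2 * n).factorial : ℝ) * Real.log ((discr K).natAbs : ℝ)) ≤ σ := by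
    have e : min c₀ 1 / 8 / (((2 * n).factorial : ℝ) * Real.log ((discr K).natAbs : ℝ)) =
        min c₀ 1 / (8 * ((2 * n).factorial : ℝ) * Real.log ((discr K).natAbs : ℝ)) := by
      rw [div_div, mul_assoc]
    have h1 : min c₀ 1 / 8 / (((2 * n).factorial : ℝ) * Real.log ((discr K).natAbs : ℝ)) ≤
        1 / (8 * ((2 * n).factorial : ℝ) * Real.log ((discr K).natAbs : ℝ)) := by
      rw [e]
      exact div_le_div_of_nonneg_right hmin1 (by positivity)
    linarith
  obtain ⟨M, hM0, κ, hM3, hMdvd, hκ, hsq, hprim, hLz⟩ :=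
    exists_dirichletCharacter_realZero_of_classGroupLFunction_eq_zero K hK χ hχ hwin hσ1 h0
  -- `3 ≤ M ≤ |d_K|`, so `1 − c₀/log M ≤ 1 − c₀/log|d_K| < σ`
  have hMle : M ≤ (discr K).natAbs := le_of_pow_dvd_sq (by omega) (by omega) hMdvd
  have hM3' : (3 : ℝ) ≤ (M : ℝ) := by exact_mod_cast hM3
  have hlogM : 0 < Real.log (M : ℝ) := Real.log_pos (by linarith)
  have hlogMle : Real.log (M : ℝ) ≤ Real.log ((discr K).natAbs : ℝ) :=
    Real.log_le_log (by linarith) (by exact_mod_cast hMle)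
  have hσM : 1 - c₀ / Real.log (M : ℝ) < σ := by
    have h8F : (1 : ℝ) ≤ 8 * ((2 * n).factorial : ℝ) := by linarith
    have e : min c₀ 1 / 8 / (((2 * n).factorial : ℝ) * Real.log ((discr K).natAbs : ℝ)) =
        min c₀ 1 / (8 * ((2 * n).factorial : ℝ)) / Real.log ((discr K).natAbs : ℝ) := by
      rw [div_div, div_div, mul_assoc]
    have h1 : min c₀ 1 / 8 / (((2 * n).factorial : ℝ) * Real.log ((discr K).natAbs : ℝ)) ≤
        c₀ / Real.log ((discr K).natAbs : ℝ) := by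
      rw [e]
      exact div_le_div_of_nonneg_right ((div_le_self hminpos.le h8F).trans hmin0) hlog.le
    have h2 : c₀ / Real.log ((discr K).natAbs : ℝ) ≤ c₀ / Real.log (M : ℝ) :=
      div_le_div_of_nonneg_left hc₀.le hlogM hlogMle
    linarith
  exact hNS M hM3 κ (MulChar.isQuadratic_iff_sq_eq_one.mpr hsq) hprim σ hσM hLz

end Literature.NumberTheory.LFunctions.NumberField

end
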